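import Mathlib

/-!
# Crux `BinomialElusive.BinomialCandidate` (stmt-ValiantsHypothesis-7392), line `registered`
# (skeleton v6) — stub `stub_nondegenerateCorankTwo`, piece B, part 1/2: the corank-two normal
# form of the Jacobian (linear algebra for `corankTwo_normalForm`)

Let `J` be an `(n₀+3) × (n₀+2)` complex matrix whose kernel is the plane spanned by two
independent vectors `κ₁, κ₂` (corank two), and let `λ_0, λ_1, λ_2` be three independent row
vectors killing the columns of `J` (`λ_a J = 0`).  `corankTwo_linearAlgebra`: there are
invertible matrices `P` (target) and `S` (source) such that the first two columns of `S` are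
`κ₁, κ₂`, the first three rows of `P` are `λ_0, λ_1, λ_2`, and `P J S = E`, where `E` has entries
`E_{l+3, l+2} = 1` (`l < n₀`) and `0` elsewhere: in the new coordinates the differential kills the
two kernel directions and maps the `(l+2)`-nd source direction to the `(l+3)`-rd target
direction, the three prescribed functionals being the special target coordinates.

Construction: `S = (κ₁ | κ₂ | w_1 | … | w_{n₀})` with `(w_l)` a basis of a complement of the
plane `ℂ κ₁ + ℂ κ₂` (`exists_source_matrix`); the columns `c_l := J S e_{l+2}` are independent
(the kernel is exactly the plane) and killed by the `λ_a`, and `P` has rows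
`(λ_0, λ_1, λ_2, L_1, …, L_{n₀})` with `L` a left inverse of `(c_l)_l` (`exists_target_matrix`);
its rows are independent because a linear relation, tested against the `c_l`, has no
`L`-component, and the `λ_a` are independent.  Also recorded: the `E`-linear forms
`Σ_l E_{i l} X_l` vanish for the special rows and equal `X_{j'+2}` for the row `j' + 3`
(`linear_E_special`, `linear_E_regular`).  This is the corank-two analogue of
`CrossCap.exists_source_matrix` / `exists_target_matrix` / `crossCap_linearAlgebra` /
`CrossCap.linear_E_*` (files `…CrossCapLinearAlgebra`, `…CrossCapNormalForm`).  Mathlib only.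
-/

-- layout Summits/ValiantsHypothesis/ValiantsHypothesis forces the duplicated namespace component
set_option linter.dupNamespace false

noncomputable section

namespace Summit.ValiantsHypothesis.ValiantsHypothesis.Theorems.BinomialCandidateStubs

open scoped BigOperators

namespace CorankTwo

variable {n₀ : ℕ}

/-- The special target indices `0, 1, 2` of `Fin (n₀ + 3)` are not of the form `l' + 3`. -/
theorem special_ne_regular (l' : Fin n₀) :
    (0 : Fin (n₀ + 3)) ≠ l'.succ.succ.succ ∧ (1 : Fin (n₀ + 3)) ≠ l'.succ.succ.succ ∧
      (2 : Fin (n₀ + 3)) ≠ l'.succ.succ.succ := by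
  refine ⟨fun h => ?_, fun h => ?_, fun h => ?_⟩
  all_goals
    rw [Fin.ext_iff] at h
    simp only [Fin.val_succ, Fin.val_zero, Fin.val_one, Fin.val_two] at h
    omega

/-- A source basis whose first two vectors are the independent `κ₁, κ₂`: an invertible `S` with
first two columns `κ₁, κ₂` (the other columns: a basis of a complement of the plane
`ℂ κ₁ + ℂ κ₂`). -/
theorem exists_source_matrix (κ₁ κ₂ : Fin (n₀ + 2) → ℂ)
    (hκ : ∀ c₁ c₂ : ℂ, c₁ • κ₁ + c₂ • κ₂ = 0 → c₁ = 0 ∧ c₂ = 0) :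
    ∃ S S' : Matrix (Fin (n₀ + 2)) (Fin (n₀ + 2)) ℂ, S * S' = 1 ∧ S' * S = 1 ∧
      (∀ l, S l 0 = κ₁ l) ∧ ∀ l, S l 1 = κ₂ l := by
  classical
  -- the kernel plane `W` and a complement `W'` with basis `b`
  have hli : LinearIndependent ℂ ![κ₁, κ₂] := by
    rw [Fintype.linearIndependent_iff]
    intro g hg i
    rw [Fin.sum_univ_two] at hg
    obtain ⟨h0, h1⟩ := hκ (g 0) (g 1) (by simpa using hg)
    fin_cases i
    · exact h0
    · exact h1
  set W : Submodule ℂ (Fin (n₀ + 2) → ℂ) := Submodule.span ℂ (Set.range ![κ₁, κ₂]) with hWdef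
  have hW : Module.finrank ℂ W = 2 := by
    rw [hWdef, finrank_span_eq_card hli, Fintype.card_fin]
  obtain ⟨W', hWW'⟩ := W.exists_isCompl
  have hW' : Module.finrank ℂ W' = n₀ := by
    have h := Submodule.finrank_add_eq_of_isCompl hWW'
    rw [hW, Module.finrank_fin_fun] at h
    omega
  let b := Module.finBasisOfFinrankEq ℂ W' hW'
  have hκ₁W : κ₁ ∈ W := Submodule.subset_span ⟨0, by simp⟩
  have hκ₂W : κ₂ ∈ W := Submodule.subset_span ⟨1, by simp⟩
  -- the matrix `S = (κ₁ | κ₂ | b)`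
  let S : Matrix (Fin (n₀ + 2)) (Fin (n₀ + 2)) ℂ := Matrix.of fun l =>
    Fin.cons (κ₁ l) (Fin.cons (κ₂ l) fun j' : Fin n₀ => (b j' : Fin (n₀ + 2) → ℂ) l)
  have hS0 : ∀ l, S l 0 = κ₁ l := fun l => by
    simp only [S, Matrix.of_apply, Fin.cons_zero]
  have hS1 : ∀ l, S l 1 = κ₂ l := fun l => by
    simp only [S, Matrix.of_apply]
    rfl
  have hSss : ∀ l (j' : Fin n₀), S l j'.succ.succ = (b j' : Fin (n₀ + 2) → ℂ) l := fun l j' => by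
    simp only [S, Matrix.of_apply, Fin.cons_succ]
  have hc0 : S.col 0 = κ₁ := funext hS0
  have hc1 : S.col 1 = κ₂ := funext hS1
  have hcss : ∀ j' : Fin n₀, S.col j'.succ.succ = (b j' : Fin (n₀ + 2) → ℂ) := fun j' =>
    funext fun l => hSss l j'
  -- the columns of `S` are independent
  have hSli : LinearIndependent ℂ S.col := by
    rw [Fintype.linearIndependent_iff]
    intro g hg
    rw [Fin.sum_univ_succ, Fin.sum_univ_succ, Fin.succ_zero_eq_one, hc0, hc1, ← add_assoc] at hg
    simp only [hcss] at hg
    have hw : g 0 • κ₁ + g 1 • κ₂ ∈ W := W.add_mem (W.smul_mem _ hκ₁W) (W.smul_mem _ hκ₂W)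
    have hw' : ∑ j' : Fin n₀, g j'.succ.succ • (b j' : Fin (n₀ + 2) → ℂ) ∈ W' :=
      W'.sum_mem fun j' _ => W'.smul_mem _ (b j').2
    have h1 : g 0 • κ₁ + g 1 • κ₂ = 0 := by
      have hmem : g 0 • κ₁ + g 1 • κ₂ ∈ W ⊓ W' := by
        refine Submodule.mem_inf.mpr ⟨hw, ?_⟩
        rw [eq_neg_of_add_eq_zero_left hg]
        exact W'.neg_mem hw'
      rwa [hWW'.inf_eq_bot, Submodule.mem_bot] at hmem
    have h2 : ∑ j' : Fin n₀, g j'.succ.succ • (b j' : Fin (n₀ + 2) → ℂ) = 0 := by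
      rwa [h1, zero_add] at hg
    obtain ⟨hg0, hg1⟩ := hκ _ _ h1
    have hb := b.linearIndependent
    rw [Fintype.linearIndependent_iff] at hb
    have h3 := hb (fun j' => g j'.succ.succ) (Subtype.ext (by
      simpa only [Submodule.coe_sum, Submodule.coe_smul, Submodule.coe_zero] using h2))
    intro j
    refine Fin.cases hg0 (fun j₁ => Fin.cases ?_ (fun j' => ?_) j₁) j
    · simpa using hg1
    · simpa using h3 j'
  have hSunit : IsUnit S := Matrix.linearIndependent_cols_iff_isUnit.mp hSli
  rw [Matrix.isUnit_iff_isUnit_det] at hSunit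
  exact ⟨S, S⁻¹, Matrix.mul_nonsing_inv S hSunit, Matrix.nonsing_inv_mul S hSunit, hS0, hS1⟩

/-- Completing `n₀` independent columns `c_l ∈ ℂ^{n₀+3}` and three independent functionals
`λ_0, λ_1, λ_2` killing them to a target basis: an invertible `P` whose rows `0, 1, 2` are
`λ_0, λ_1, λ_2` and with `P c_l = e_{l+3}` (the remaining rows: a left inverse of `(c_l)_l`). -/
theorem exists_target_matrix (C : Matrix (Fin (n₀ + 3)) (Fin n₀) ℂ)
    (hC : Function.Injective C.mulVec) (lam : Fin 3 → Fin (n₀ + 3) → ℂ)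
    (hlamC : ∀ a l', ∑ i', lam a i' * C i' l' = 0)
    (hlam : ∀ c : Fin 3 → ℂ, (∀ i, ∑ a, c a * lam a i = 0) → c = 0) :
    ∃ P P' : Matrix (Fin (n₀ + 3)) (Fin (n₀ + 3)) ℂ, P * P' = 1 ∧ P' * P = 1 ∧
      (∀ i, P 0 i = lam 0 i ∧ P 1 i = lam 1 i ∧ P 2 i = lam 2 i) ∧
      ∀ (i : Fin (n₀ + 3)) (l' : Fin n₀), (P * C) i l' = if i = l'.succ.succ.succ then 1 else 0 := by
  classical
  -- a left inverse
  have hC' : Function.Injective C.mulVecLin := fun v w h => hC (by simpa using h)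
  obtain ⟨g, hg⟩ := LinearMap.exists_leftInverse_of_injective C.mulVecLin
    (LinearMap.ker_eq_bot.mpr hC')
  let L : Matrix (Fin n₀) (Fin (n₀ + 3)) ℂ := LinearMap.toMatrix' g
  have hL : ∀ j' l' : Fin n₀, ∑ i', L j' i' * C i' l' = if j' = l' then 1 else 0 := by
    intro j' l'
    have h1 : L.mulVec (C.mulVec (Pi.single l' 1)) = Pi.single l' 1 := by
      have := congrArg (fun φ => φ (Pi.single l' 1)) hg
      simpa [L, LinearMap.toMatrix'_mulVec] using this
    have := congrFun h1 j'
    simp only [Matrix.mulVec, dotProduct, Pi.single_apply, mul_ite, mul_one, mul_zero,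
      Finset.sum_ite_eq', Finset.mem_univ, if_true] at this
    exact this
  -- the matrix `P` with rows `(λ_0, λ_1, λ_2, L)`
  let P : Matrix (Fin (n₀ + 3)) (Fin (n₀ + 3)) ℂ :=
    Matrix.of (Fin.cons (lam 0) (Fin.cons (lam 1) (Fin.cons (lam 2) fun j' => L j')))
  have hP0 : P 0 = lam 0 := funext fun j => by simp only [P, Matrix.of_apply, Fin.cons_zero]
  have hP1 : P 1 = lam 1 := funext fun j => by
    simp only [P, Matrix.of_apply]
    rfl
  have hP2 : P 2 = lam 2 := funext fun j => by
    simp only [P, Matrix.of_apply]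
    rfl
  have hPsss : ∀ j', P j'.succ.succ.succ = L j' := fun j' => funext fun j => by
    simp only [P, Matrix.of_apply, Fin.cons_succ]
  have hPC : ∀ (i : Fin (n₀ + 3)) (l' : Fin n₀),
      ∑ i', P i i' * C i' l' = if i = l'.succ.succ.succ then 1 else 0 := by
    intro i l'
    obtain ⟨h0, h1, h2⟩ := special_ne_regular l'
    refine Fin.cases ?_ (fun i₁ => ?_) i
    · rw [hP0, hlamC, if_neg h0]
    · refine Fin.cases ?_ (fun i₂ => ?_) i₁
      · rw [Fin.succ_zero_eq_one, hP1, hlamC, if_neg h1]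
      · refine Fin.cases ?_ (fun j' => ?_) i₂
        · rw [Fin.succ_zero_eq_one, Fin.succ_one_eq_two, hP2, hlamC, if_neg h2]
        · rw [hPsss, hL]
          by_cases h : j' = l'
          · subst h; simp
          · rw [if_neg h, if_neg (fun h' => h (Fin.succ_injective _
              (Fin.succ_injective _ (Fin.succ_injective _ h'))))]
  -- the rows of `P` are independent
  have hPli : LinearIndependent ℂ (fun i => P i) := by
    rw [Fintype.linearIndependent_iff]
    intro a ha
    have hsss : ∀ l' : Fin n₀, a l'.succ.succ.succ = 0 := by
      intro l'
      have := congrArg (fun r : Fin (n₀ + 3) → ℂ => ∑ i', r i' * C i' l') ha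
      simp only [Finset.sum_apply, Pi.smul_apply, smul_eq_mul, Finset.sum_mul, Pi.zero_apply,
        zero_mul, Finset.sum_const_zero] at this
      rw [Finset.sum_comm] at this
      simp only [mul_assoc, ← Finset.mul_sum, hPC, mul_ite, mul_one, mul_zero,
        Finset.sum_ite_eq', Finset.mem_univ, if_true] at this
      exact this
    have h012 : ∀ i, ∑ b : Fin 3, ![a 0, a 1, a 2] b * lam b i = 0 := by
      intro i
      have := congrFun ha i
      simp only [Finset.sum_apply, Pi.smul_apply, smul_eq_mul, Fin.sum_univ_succ (n := n₀ + 2),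
        Fin.sum_univ_succ (n := n₀ + 1), Fin.sum_univ_succ (n := n₀), hsss, zero_mul,
        Finset.sum_const_zero, add_zero, Fin.succ_zero_eq_one, Fin.succ_one_eq_two,
        Pi.zero_apply] at this
      rw [hP0, hP1, hP2] at this
      rw [Fin.sum_univ_three]
      simpa [add_assoc] using this
    have hc := hlam _ h012
    intro i
    refine Fin.cases ?_ (fun i₁ => Fin.cases ?_ (fun i₂ => Fin.cases ?_ (fun j' => hsss j') i₂) i₁) i
    · simpa using congrFun hc 0
    · simpa using congrFun hc 1
    · simpa using congrFun hc 2
  have hPunit : IsUnit P := Matrix.linearIndependent_rows_iff_isUnit.mp hPli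
  rw [Matrix.isUnit_iff_isUnit_det] at hPunit
  refine ⟨P, P⁻¹, Matrix.mul_nonsing_inv P hPunit, Matrix.nonsing_inv_mul P hPunit,
    fun i => ⟨congrFun hP0 i, congrFun hP1 i, congrFun hP2 i⟩, fun i l' => ?_⟩
  rw [Matrix.mul_apply]
  exact hPC i l'

section LinearE

open MvPolynomial

variable (E : Matrix (Fin (n₀ + 3)) (Fin (n₀ + 2)) ℂ) (hE0 : ∀ i, E i 0 = 0) (hE1 : ∀ i, E i 1 = 0)
  (hEs : ∀ i (l' : Fin n₀), E i l'.succ.succ = if i = l'.succ.succ.succ then 1 else 0)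
include hE0 hE1 hEs

/-- The `E`-linear form of the row `i`: `Σ_l E_{i l} X_l = Σ_{l'} [i = l' + 3] X_{l'+2}`. -/
theorem linear_E_eq (i : Fin (n₀ + 3)) :
    (∑ l, C (E i l) * X l : MvPolynomial (Fin (n₀ + 2)) ℂ) =
      ∑ l' : Fin n₀, if i = l'.succ.succ.succ then X l'.succ.succ else 0 := by
  rw [Fin.sum_univ_succ, hE0, C_0, zero_mul, zero_add, Fin.sum_univ_succ, Fin.succ_zero_eq_one,
    hE1, C_0, zero_mul, zero_add]
  refine Finset.sum_congr rfl fun l' _ => ?_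
  rw [hEs]
  split_ifs <;> simp

/-- The `E`-linear form of a special target index (one not of the form `l' + 3`) vanishes. -/
theorem linear_E_special {i : Fin (n₀ + 3)} (hi : ∀ l' : Fin n₀, i ≠ l'.succ.succ.succ) :
    (∑ l, C (E i l) * X l : MvPolynomial (Fin (n₀ + 2)) ℂ) = 0 := by
  rw [linear_E_eq E hE0 hE1 hEs]
  exact Finset.sum_eq_zero fun l' _ => if_neg (hi l')

/-- The `E`-linear form of the regular target index `j' + 3` is `X_{j'+2}`. -/
theorem linear_E_regular (j' : Fin n₀) :
    (∑ l, C (E j'.succ.succ.succ l) * X l : MvPolynomial (Fin (n₀ + 2)) ℂ) = X j'.succ.succ := by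
  rw [linear_E_eq E hE0 hE1 hEs, Finset.sum_eq_single j', if_pos rfl]
  · intro l' _ hl'
    rw [if_neg]
    exact fun h => hl' (Fin.succ_injective _ (Fin.succ_injective _ (Fin.succ_injective _ h))).symm
  · exact fun h => absurd (Finset.mem_univ _) h

end LinearE

end CorankTwo

open CorankTwo in
/-- **Corank-two normal form of the Jacobian** (linear algebra of the helper
`corankTwo_normalForm`, piece B of the stub `stub_nondegenerateCorankTwo`): for an
`(n₀+3) × (n₀+2)` matrix `J` with kernel the plane `ℂ κ₁ + ℂ κ₂` (`κ₁, κ₂` independent) and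
three independent row vectors `λ_a` with `λ_a J = 0`, there are invertible `P`, `S` with
`S e_0 = κ₁`, `S e_1 = κ₂`, rows `0, 1, 2` of `P` equal to `λ_0, λ_1, λ_2`, and `P J S = E`,
`E_{l+3,l+2} = 1` and all other entries `0`. -/
theorem corankTwo_linearAlgebra :
    ∀ (n₀ : ℕ) (J : Matrix (Fin (n₀ + 3)) (Fin (n₀ + 2)) ℂ) (κ₁ κ₂ : Fin (n₀ + 2) → ℂ)
      (lam : Fin 3 → Fin (n₀ + 3) → ℂ),
      J.mulVec κ₁ = 0 → J.mulVec κ₂ = 0 →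
      (∀ c₁ c₂ : ℂ, c₁ • κ₁ + c₂ • κ₂ = 0 → c₁ = 0 ∧ c₂ = 0) →
      (∀ κ' : Fin (n₀ + 2) → ℂ, J.mulVec κ' = 0 → ∃ μ₁ μ₂ : ℂ, κ' = μ₁ • κ₁ + μ₂ • κ₂) →
      (∀ a j, ∑ i, lam a i * J i j = 0) →
      (∀ c : Fin 3 → ℂ, (∀ i, ∑ a, c a * lam a i = 0) → c = 0) →
      ∃ (P P' : Matrix (Fin (n₀ + 3)) (Fin (n₀ + 3)) ℂ)
        (S S' : Matrix (Fin (n₀ + 2)) (Fin (n₀ + 2)) ℂ),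
        P * P' = 1 ∧ P' * P = 1 ∧ S * S' = 1 ∧ S' * S = 1 ∧
        (∀ l, S l 0 = κ₁ l) ∧ (∀ l, S l 1 = κ₂ l) ∧
        (∀ i, P 0 i = lam 0 i ∧ P 1 i = lam 1 i ∧ P 2 i = lam 2 i) ∧
        (∀ i, (P * J * S) i 0 = 0) ∧ (∀ i, (P * J * S) i 1 = 0) ∧
        ∀ i (l' : Fin n₀), (P * J * S) i l'.succ.succ = if i = l'.succ.succ.succ then 1 else 0 := by
  intro n₀ J κ₁ κ₂ lam hJκ₁ hJκ₂ hκ hcorank hlamJ hlam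
  classical
  obtain ⟨S, S', hSS', hS'S, hS0, hS1⟩ := exists_source_matrix κ₁ κ₂ hκ
  -- the regular columns of `J S`
  let C : Matrix (Fin (n₀ + 3)) (Fin n₀) ℂ := Matrix.of fun i l' => (J * S) i l'.succ.succ
  have hcol0 : ∀ i, (J * S) i 0 = 0 := by
    intro i
    have := congrFun hJκ₁ i
    rw [Matrix.mul_apply]
    simpa [Matrix.mulVec, dotProduct, hS0] using this
  have hcol1 : ∀ i, (J * S) i 1 = 0 := by
    intro i
    have := congrFun hJκ₂ i
    rw [Matrix.mul_apply]
    simpa [Matrix.mulVec, dotProduct, hS1] using this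
  have hCmul : ∀ u : Fin n₀ → ℂ, C.mulVec u = (J * S).mulVec (Fin.cons 0 (Fin.cons 0 u)) := by
    intro u
    funext i
    simp [C, Matrix.mulVec, dotProduct, Fin.sum_univ_succ, hcol0, hcol1]
  have hC : Function.Injective C.mulVec := by
    have key : ∀ u : Fin n₀ → ℂ, C.mulVec u = 0 → u = 0 := by
      intro u hu
      rw [hCmul, ← Matrix.mulVec_mulVec] at hu
      obtain ⟨μ₁, μ₂, hμ⟩ := hcorank _ hu
      have hSe0 : S.mulVec (Pi.single 0 1) = κ₁ := by
        rw [Matrix.mulVec_single_one]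
        funext l
        exact hS0 l
      have hSe1 : S.mulVec (Pi.single 1 1) = κ₂ := by
        rw [Matrix.mulVec_single_one]
        funext l
        exact hS1 l
      have h2 : S.mulVec (Fin.cons 0 (Fin.cons 0 u) -
          (μ₁ • Pi.single 0 1 + μ₂ • Pi.single 1 1)) = 0 := by
        rw [Matrix.mulVec_sub, Matrix.mulVec_add, Matrix.mulVec_smul, Matrix.mulVec_smul, hSe0,
          hSe1, hμ, sub_self]
      have h3 : Fin.cons 0 (Fin.cons 0 u) -
          (μ₁ • (Pi.single 0 1 : Fin (n₀ + 2) → ℂ) + μ₂ • Pi.single 1 1) = 0 := by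
        have := congrArg S'.mulVec h2
        rwa [Matrix.mulVec_mulVec, hS'S, Matrix.one_mulVec, Matrix.mulVec_zero] at this
      funext l'
      have := congrFun h3 l'.succ.succ
      simpa [Pi.single_apply, Fin.succ_ne_zero, Fin.succ_succ_ne_one] using this
    intro v w hvw
    have : C.mulVec (v - w) = 0 := by rw [Matrix.mulVec_sub, hvw, sub_self]
    exact sub_eq_zero.mp (key _ this)
  have hlamC : ∀ a l', ∑ i', lam a i' * C i' l' = 0 := by
    intro a l'
    simp only [C, Matrix.of_apply, Matrix.mul_apply, Finset.mul_sum]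
    rw [Finset.sum_comm]
    simp_rw [← mul_assoc, ← Finset.sum_mul, hlamJ, zero_mul, Finset.sum_const_zero]
  obtain ⟨P, P', hPP', hP'P, hProws, hPC⟩ := exists_target_matrix C hC lam hlamC hlam
  refine ⟨P, P', S, S', hPP', hP'P, hSS', hS'S, hS0, hS1, hProws, fun i => ?_, fun i => ?_,
    fun i l' => ?_⟩
  · rw [Matrix.mul_assoc, Matrix.mul_apply]
    simp [hcol0]
  · rw [Matrix.mul_assoc, Matrix.mul_apply]
    simp [hcol1]
  · rw [Matrix.mul_assoc, Matrix.mul_apply, ← hPC i l']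
    rfl

end Summit.ValiantsHypothesis.ValiantsHypothesis.Theorems.BinomialCandidateStubs

end
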